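import Literature.Geometry.Symplectic.PlanarHomologySphereFillingsPALF
import Literature.Topology.FourManifolds.DoubleCancellationSlabs
import HarnessLib

/-!
# Oba 2016, Thm. 1.1 (`Oba2016_steinFilling_fourHoledSphere`): the two cancellations done in the
# tree — the fact modulo Wendl's PALF, Kas' count and Kas' incidences in two-slab form

Topic `Literature/Geometry/Symplectic`; fourth proofs-only companion of
`PlanarHomologySphereFillings.lean` (after `…Proofs.lean`, `…Dictionary.lean`, `…PALF.lean`).
Everything here is PROVED; no definition and no named fact is introduced (D-0026).

`PlanarHomologySphereFillingsPALF.lean` §5 reduces the fact to Wendl's theorem (`hW`), Kas'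
handle count (`hK`) and the residual claim `hC` — Oba's §3.2 endgame *"we can find two
cancelling `1`-handle/`2`-handle pairs in the diagram"* — and its §6 records the slide-free plan
for `hC` in Milnor's vocabulary: two pairs `(p₁, q_α)`, `(p₂, q_β)` of critical points of
indices `1`/`2` of Kas' Morse function, each alone in a slab and meeting the hypotheses of the
First Cancellation Theorem in a level of its slab.  The Morse-theoretic half of that plan is
now a theorem of the tree (`DoubleCancellationSlabs.lean`:
`Cobordism.exists_firstCancellation_two_slabs`, `exists_isMorseAdapted_ncard_one_sub_two_of_two_slabs`,
over the PROVED `Cobordism.Milnor1965_firstCancellation_slab_holds`).  This file performs the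
two cancellations and leaves as hypothesis only their INPUT:

* `hI` — **Kas' handlebody WITH incidences, in two-slab form** (Kas 1980; Gompf–Stipsicz 1999,
  §8.2 with the handle reordering of §4.2; Oba 2016, §2.2 and §3.2): a compact contractible
  `W` carrying a planar `PALF` with `n + 1 ∈ {3, 4}` binding components carries a Morse function
  `g` on the triad `(W; ∅, ∂W)` with a smooth gradient-like field, all critical points of index
  `≤ 2`, at most `n` of index `1`, and two `1`/`2` pairs `(p, p')`, `(r, r')` alone in disjoint
  slabs `g⁻¹[a₀, a₁]`, `g⁻¹[a₂, a₃]` (`0 < a₀`, `a₁ < a₂`, `a₃ < 1`) whose spheres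
  `S_R(p) ∩ S_L(p')`, `S_R(r) ∩ S_L(r')` are single transverse points in levels `b`, `b'` of
  the slabs.  (What a proof of `hI` from `P : PALF o b` must do is spelled out in §6 of
  `…PALF.lean`: Kas' Morse function with hand spheres = crossings of vanishing cycles with a
  cutting arc system, in an admissible order of critical values; `H₁(W) = 0` ⇒ a unimodular
  hole-incidence matrix ⇒ a boundary-parallel cycle `α ∥ ∂_a` (parity) and a second cycle `β`;
  arcs `u₁` across `α`, `u₂` across `β` off the collar of `∂_a`.)

## Results

* §1 `hasHandleDecomposition_oneHandle_le_one_of_two_slabs` — pure Morse theory on a compact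
  `4`-manifold with boundary: a Morse function on `(W; ∅, ∂W)` with indices `≤ 2`, at most three
  critical points of index `1` and two `1`/`2` pairs in cancelling position in disjoint slabs
  gives a handle decomposition with at most one `1`-handle and no handle of index `≥ 3`.
* §2 `Oba2016_cancel_of_kasIncidence (hI)` — the residual claim `hC` of `…PALF.lean` §5 from
  `hI`; **`Oba2016_steinFilling_fourHoledSphere_of_wendl_of_kas_of_kasIncidence (hW hK hI)`** —
  the fact from Wendl, Kas' count and Kas' incidences in two-slab form: no cancellation is
  hypothesised any more.

## References
* T. Oba, *Stein fillings of homology 3-spheres and mapping class groups*, Geom. Dedicata 183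
  (2016); arXiv:1407.5257: Thm. 1.1 and its proof, §3.2 (p. 8), §2.2 (p. 5). [Oba2016]
* A. Kas, *On the handlebody decomposition associated to a Lefschetz fibration*, Pacific J. Math.
  89 (1980), 89–104. [Kas1980]
* R. E. Gompf, A. I. Stipsicz, *4-Manifolds and Kirby Calculus*, GSM 20 (1999), §4.2, §8.2.
  [GompfStipsiczGSM1999]
* J. Milnor, *Lectures on the h-cobordism theorem* (1965), Thm. 5.4 (PDF p. 27).
  [MilnorHCobordism1965]
-/

noncomputable section

open Set Function
open scoped Manifold ContDiff Topology

namespace Literature.Geometry.Symplectic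

open Literature.Topology.FourManifolds

/-! ### §1 Two cancelling pairs in disjoint slabs leave at most one `1`-handle -/

/-- **Two `1`/`2` pairs in cancelling position in disjoint slabs leave at most one `1`-handle.**
Let `W` be a compact `4`-manifold with boundary and `g` a Morse function on the triad
`(W; ∅, ∂W)` (`Cobordism.ofBoundary 3 W`) with smooth gradient-like `ξ`, all of whose critical
points have index `≤ 2` and at most three of which have index `1`; suppose two pairs `(p, p')`,
`(r, r')` of critical points of indices `1`/`2` lie alone in disjoint slabs `g⁻¹[a₀, a₁]`,
`g⁻¹[a₂, a₃]` (`0 < a₀`, `a₁ < a₂`, `a₃ < 1`) with `S_R(p) ∩ S_L(p') = {x₀}` transversely in the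
level `g = b` of the first and `S_R(r) ∩ S_L(r') = {y₀}` transversely in the level `g = b'` of
the second.  Then `W` has a handle decomposition with at most one `1`-handle and no handle of
index `≥ 3` (Milnor's Thm. 5.4 in each slab, `exists_isMorseAdapted_ncard_one_sub_two_of_two_slabs`,
and the count of the critical points of the resulting adapted Morse function).
[cite: MilnorHCobordism1965, Thm. 5.4 (PDF p. 27)] [cite: Oba2016, §3.2 (p. 8)] -/
theorem hasHandleDecomposition_oneHandle_le_one_of_two_slabs {W : Type} [TopologicalSpace W]
    [T2Space W] [SecondCountableTopology W] [CompactSpace W]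
    [ChartedSpace (EuclideanHalfSpace 4) W] [IsManifold (𝓡∂ 4) ∞ W] {g : W → ℝ}
    (hg : (Cobordism.ofBoundary 3 W).IsMorseFunction g)
    (ξ : Cₛ^∞⟮𝓡∂ 4; EuclideanSpace ℝ (Fin 4), (TangentSpace (𝓡∂ 4) : W → Type)⟯)
    (hξ : IsGradientLike (𝓡∂ 4) g ξ)
    (hidx : ∀ z, IsMCriticalPt (𝓡∂ 4) g z → morseIndex (𝓡∂ 4) g z ≤ 2)
    (hone : (criticalSetOfIndex (𝓡∂ 4) g 1).ncard ≤ 3)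
    {a₀ a₁ a₂ a₃ b b' : ℝ} (ha₀ : 0 < a₀) (ha₁₂ : a₁ < a₂) (ha₃ : a₃ < 1) {p p' r r' : W}
    (hp : p ∈ criticalSetOfIndex (𝓡∂ 4) g 1) (hp' : p' ∈ criticalSetOfIndex (𝓡∂ 4) g 2)
    (h₁ : a₀ < g p) (h₂ : g p < b) (h₃ : b < g p') (h₄ : g p' < a₁)
    (honly : ∀ z ∈ criticalSet (𝓡∂ 4) g, g z ∈ Icc a₀ a₁ → z = p ∨ z = p') {x₀ : W}
    (hx₀ : rightHandSphere (𝓡∂ 4) g ξ p b ∩ leftHandSphere (𝓡∂ 4) g ξ p' b = {x₀})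
    (htr : IsTransverseInLevel (𝓡∂ 4) (g ⁻¹' {b}) (rightHandSphere (𝓡∂ 4) g ξ p b)
      (leftHandSphere (𝓡∂ 4) g ξ p' b) x₀)
    (hr : r ∈ criticalSetOfIndex (𝓡∂ 4) g 1) (hr' : r' ∈ criticalSetOfIndex (𝓡∂ 4) g 2)
    (h₅ : a₂ < g r) (h₆ : g r < b') (h₇ : b' < g r') (h₈ : g r' < a₃)
    (honly' : ∀ z ∈ criticalSet (𝓡∂ 4) g, g z ∈ Icc a₂ a₃ → z = r ∨ z = r') {y₀ : W}
    (hy₀ : rightHandSphere (𝓡∂ 4) g ξ r b' ∩ leftHandSphere (𝓡∂ 4) g ξ r' b' = {y₀})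
    (htr' : IsTransverseInLevel (𝓡∂ 4) (g ⁻¹' {b'}) (rightHandSphere (𝓡∂ 4) g ξ r b')
      (leftHandSphere (𝓡∂ 4) g ξ r' b') y₀) :
    ∃ c : ℕ → ℕ, HasHandleDecomposition 3 W c ∧ c 1 ≤ 1 ∧ ∀ k, 3 ≤ k → c k = 0 := by
  obtain ⟨f, hf, hcount, -, hidx'⟩ :=
    exists_isMorseAdapted_ncard_one_sub_two_of_two_slabs (n := 3) hg ξ hξ ha₀ ha₁₂ ha₃ hp hp' h₁
      h₂ h₃ h₄ honly hx₀ htr hr hr' h₅ h₆ h₇ h₈ honly' hy₀ htr' hidx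
  have hf' : IsMorseAdapted (𝓡∂ 4) f := hf
  have hfin : ∀ k, (criticalSetOfIndex (𝓡∂ 4) f k).Finite := fun k =>
    (IsMorse.finite_criticalSet_holds hf'.isMorse).subset (criticalSetOfIndex_subset _ f k)
  refine ⟨fun k => (criticalSetOfIndex (𝓡∂ 4) f k).ncard, ⟨f, hf', fun k => rfl⟩, ?_,
    fun k hk => ?_⟩
  · show (criticalSetOfIndex (𝓡∂ 4) f 1).ncard ≤ 1
    have : (criticalSetOfIndex (𝓡∂ 4) f 1).ncard + 2 = (criticalSetOfIndex (𝓡∂ 4) g 1).ncard :=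
      hcount
    omega
  · show (criticalSetOfIndex (𝓡∂ 4) f k).ncard = 0
    rw [Set.ncard_eq_zero (hfin k)]
    refine Set.eq_empty_of_forall_notMem fun x hx => ?_
    have hle : morseIndex (𝓡∂ 4) f x ≤ 2 := hidx' x hx.1
    rw [hx.2] at hle
    omega

/-! ### §2 The fact from Wendl, Kas' count and Kas' incidences in two-slab form -/

/-- **The residual claim `hC` of `Oba2016_steinFilling_fourHoledSphere_of_wendl_of_kas_of_cancel`
from Kas' incidences in two-slab form.**  Hypothesis `hI` (module docstring): every compact
contractible `W` with a planar `PALF` of `n + 1 ∈ {3, 4}` binding components carries a Morse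
function on `(W; ∅, ∂W)` with smooth gradient-like field, indices `≤ 2`, at most `n` critical
points of index `1`, and two `1`/`2` pairs in cancelling position in disjoint slabs.  Conclusion:
such a `W` has a handle decomposition with at most one `1`-handle and none of index `≥ 3`
(§1). [cite: Oba2016, §3.2 (p. 8)] [cite: MilnorHCobordism1965, Thm. 5.4 (PDF p. 27)] -/
theorem Oba2016_cancel_of_kasIncidence
    (hI : ∀ (W : Type) [TopologicalSpace W] [T2Space W] [SecondCountableTopology W]
      [ChartedSpace (EuclideanHalfSpace 4) W] [IsManifold (𝓡∂ 4) ∞ W] [CompactSpace W]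
      [ContractibleSpace W] (S : SteinStructure W) (b : BoundaryData (𝓡∂ 4) W (𝓡 3))
      (P : PALF S.complexOrientation b) (n : ℕ), P.ob.IsPlanar →
      Nat.card (ConnectedComponents P.ob.binding) = n + 1 → 2 ≤ n → n ≤ 3 →
      ∃ (g : W → ℝ) (ξ : Cₛ^∞⟮𝓡∂ 4; EuclideanSpace ℝ (Fin 4), (TangentSpace (𝓡∂ 4) : W → Type)⟯)
        (a₀ a₁ a₂ a₃ c c' : ℝ) (p p' r r' x₀ y₀ : W),
        (Cobordism.ofBoundary 3 W).IsMorseFunction g ∧ IsGradientLike (𝓡∂ 4) g ξ ∧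
        (∀ z, IsMCriticalPt (𝓡∂ 4) g z → morseIndex (𝓡∂ 4) g z ≤ 2) ∧
        (criticalSetOfIndex (𝓡∂ 4) g 1).ncard ≤ n ∧
        0 < a₀ ∧ a₁ < a₂ ∧ a₃ < 1 ∧
        p ∈ criticalSetOfIndex (𝓡∂ 4) g 1 ∧ p' ∈ criticalSetOfIndex (𝓡∂ 4) g 2 ∧
        a₀ < g p ∧ g p < c ∧ c < g p' ∧ g p' < a₁ ∧
        (∀ z ∈ criticalSet (𝓡∂ 4) g, g z ∈ Icc a₀ a₁ → z = p ∨ z = p') ∧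
        rightHandSphere (𝓡∂ 4) g ξ p c ∩ leftHandSphere (𝓡∂ 4) g ξ p' c = {x₀} ∧
        IsTransverseInLevel (𝓡∂ 4) (g ⁻¹' {c}) (rightHandSphere (𝓡∂ 4) g ξ p c)
          (leftHandSphere (𝓡∂ 4) g ξ p' c) x₀ ∧
        r ∈ criticalSetOfIndex (𝓡∂ 4) g 1 ∧ r' ∈ criticalSetOfIndex (𝓡∂ 4) g 2 ∧
        a₂ < g r ∧ g r < c' ∧ c' < g r' ∧ g r' < a₃ ∧
        (∀ z ∈ criticalSet (𝓡∂ 4) g, g z ∈ Icc a₂ a₃ → z = r ∨ z = r') ∧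
        rightHandSphere (𝓡∂ 4) g ξ r c' ∩ leftHandSphere (𝓡∂ 4) g ξ r' c' = {y₀} ∧
        IsTransverseInLevel (𝓡∂ 4) (g ⁻¹' {c'}) (rightHandSphere (𝓡∂ 4) g ξ r c')
          (leftHandSphere (𝓡∂ 4) g ξ r' c') y₀) :
    ∀ (W : Type) [TopologicalSpace W] [T2Space W] [SecondCountableTopology W]
      [ChartedSpace (EuclideanHalfSpace 4) W] [IsManifold (𝓡∂ 4) ∞ W] [CompactSpace W]
      [ContractibleSpace W] (S : SteinStructure W) (b : BoundaryData (𝓡∂ 4) W (𝓡 3))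
      (P : PALF S.complexOrientation b) (n : ℕ), P.ob.IsPlanar →
      Nat.card (ConnectedComponents P.ob.binding) = n + 1 → 2 ≤ n → n ≤ 3 →
      HasHandleDecomposition 3 W
        (fun k => if k = 0 then 1 else if k = 1 then n else if k = 2 then n else 0) →
      ∃ c : ℕ → ℕ, HasHandleDecomposition 3 W c ∧ c 1 ≤ 1 ∧ ∀ k, 3 ≤ k → c k = 0 := by
  intro W _ _ _ _ _ _ _ S b P n hpl hn h2 h3 _
  obtain ⟨g, ξ, a₀, a₁, a₂, a₃, c, c', p, p', r, r', x₀, y₀, hg, hξ, hidx, hone, ha₀, ha₁₂, ha₃,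
    hp, hp', h₁, h₂, h₃, h₄, honly, hx₀, htr, hr, hr', h₅, h₆, h₇, h₈, honly', hy₀, htr'⟩ :=
    hI W S b P n hpl hn h2 h3
  exact hasHandleDecomposition_oneHandle_le_one_of_two_slabs hg ξ hξ hidx (hone.trans h3) ha₀
    ha₁₂ ha₃ hp hp' h₁ h₂ h₃ h₄ honly hx₀ htr hr hr' h₅ h₆ h₇ h₈ honly' hy₀ htr'

/-- **Oba 2016, Thm. 1.1 (the tree's fact `Oba2016_steinFilling_fourHoledSphere`) from Wendl's
theorem, Kas' handle count and Kas' incidences in two-slab form** — the two handle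
cancellations of Oba's §3.2 are now done in the tree (Milnor's Thm. 5.4 twice,
`DoubleCancellationSlabs.lean`).  Hypotheses: `hW`, `hK` as in
`Oba2016_steinFilling_fourHoledSphere_of_wendl_of_kas_of_cancel` (`…PALF.lean` §5: Wendl 2010,
Thm. 1 over `PALF`; Kas' count `(1, n, #crit, 0, 0)`), and `hI` as in
`Oba2016_cancel_of_kasIncidence` (Kas' incidences: two `1`/`2` pairs in cancelling position in
disjoint slabs, for planar PALFs with `3` or `4` binding components on a contractible total
space).  None of the three is within the tree's proved depth; all are hypotheses, not named facts
(D-0026). [cite: Oba2016, Thm. 1.1 and its proof (§3.2, p. 8), Thm. 1.3, §2.2 (p. 5)]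
[cite: Wendl2010, Thm. 1] [cite: Kas1980] [cite: MilnorHCobordism1965, Thm. 5.4 (PDF p. 27)] -/
theorem Oba2016_steinFilling_fourHoledSphere_of_wendl_of_kas_of_kasIncidence
    (hW : ∀ (W : Type) [TopologicalSpace W] [T2Space W] [SecondCountableTopology W]
      [ChartedSpace (EuclideanHalfSpace 4) W] [IsManifold (𝓡∂ 4) ∞ W] [CompactSpace W]
      [ConnectedSpace W] (S : SteinStructure W) (b : BoundaryData (𝓡∂ 4) W (𝓡 3))
      (K : OpenBook b.carrier), K.IsPlanar → K.Supports (boundaryPlaneField S.J b) →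
      ∃ P : PALF S.complexOrientation b, P.ob.IsPlanar ∧ Nonempty (P.ob.binding ≃ₜ K.binding))
    (hK : ∀ (W : Type) [TopologicalSpace W] [T2Space W] [SecondCountableTopology W]
      [ChartedSpace (EuclideanHalfSpace 4) W] [IsManifold (𝓡∂ 4) ∞ W] [CompactSpace W]
      [ConnectedSpace W] (o : SmoothOrientation (𝓡∂ 4) W) (b : BoundaryData (𝓡∂ 4) W (𝓡 3))
      (P : PALF o b) (n : ℕ), P.ob.IsPlanar →
      Nat.card (ConnectedComponents P.ob.binding) = n + 1 →
      HasHandleDecomposition 3 W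
        (fun k => if k = 0 then 1 else if k = 1 then n else if k = 2 then P.crit.card else 0))
    (hI : ∀ (W : Type) [TopologicalSpace W] [T2Space W] [SecondCountableTopology W]
      [ChartedSpace (EuclideanHalfSpace 4) W] [IsManifold (𝓡∂ 4) ∞ W] [CompactSpace W]
      [ContractibleSpace W] (S : SteinStructure W) (b : BoundaryData (𝓡∂ 4) W (𝓡 3))
      (P : PALF S.complexOrientation b) (n : ℕ), P.ob.IsPlanar →
      Nat.card (ConnectedComponents P.ob.binding) = n + 1 → 2 ≤ n → n ≤ 3 →
      ∃ (g : W → ℝ) (ξ : Cₛ^∞⟮𝓡∂ 4; EuclideanSpace ℝ (Fin 4), (TangentSpace (𝓡∂ 4) : W → Type)⟯)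
        (a₀ a₁ a₂ a₃ c c' : ℝ) (p p' r r' x₀ y₀ : W),
        (Cobordism.ofBoundary 3 W).IsMorseFunction g ∧ IsGradientLike (𝓡∂ 4) g ξ ∧
        (∀ z, IsMCriticalPt (𝓡∂ 4) g z → morseIndex (𝓡∂ 4) g z ≤ 2) ∧
        (criticalSetOfIndex (𝓡∂ 4) g 1).ncard ≤ n ∧
        0 < a₀ ∧ a₁ < a₂ ∧ a₃ < 1 ∧
        p ∈ criticalSetOfIndex (𝓡∂ 4) g 1 ∧ p' ∈ criticalSetOfIndex (𝓡∂ 4) g 2 ∧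
        a₀ < g p ∧ g p < c ∧ c < g p' ∧ g p' < a₁ ∧
        (∀ z ∈ criticalSet (𝓡∂ 4) g, g z ∈ Icc a₀ a₁ → z = p ∨ z = p') ∧
        rightHandSphere (𝓡∂ 4) g ξ p c ∩ leftHandSphere (𝓡∂ 4) g ξ p' c = {x₀} ∧
        IsTransverseInLevel (𝓡∂ 4) (g ⁻¹' {c}) (rightHandSphere (𝓡∂ 4) g ξ p c)
          (leftHandSphere (𝓡∂ 4) g ξ p' c) x₀ ∧
        r ∈ criticalSetOfIndex (𝓡∂ 4) g 1 ∧ r' ∈ criticalSetOfIndex (𝓡∂ 4) g 2 ∧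
        a₂ < g r ∧ g r < c' ∧ c' < g r' ∧ g r' < a₃ ∧
        (∀ z ∈ criticalSet (𝓡∂ 4) g, g z ∈ Icc a₂ a₃ → z = r ∨ z = r') ∧
        rightHandSphere (𝓡∂ 4) g ξ r c' ∩ leftHandSphere (𝓡∂ 4) g ξ r' c' = {y₀} ∧
        IsTransverseInLevel (𝓡∂ 4) (g ⁻¹' {c'}) (rightHandSphere (𝓡∂ 4) g ξ r c')
          (leftHandSphere (𝓡∂ 4) g ξ r' c') y₀) :
    Oba2016_steinFilling_fourHoledSphere :=
  Oba2016_steinFilling_fourHoledSphere_of_wendl_of_kas_of_cancel hW hK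
    (Oba2016_cancel_of_kasIncidence hI)

end Literature.Geometry.Symplectic

end
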